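import Summits.ValiantsHypothesis.ValiantsHypothesis.Theorems.ImmanantSliceGadgetK
import Summits.ValiantsHypothesis.ValiantsHypothesis.Theorems.ImmanantSliceEvenCyclesColoring
import Summits.ValiantsHypothesis.ValiantsHypothesis.Theorems.ImmanantSliceMonotoneRigidity

/-!
# Route ImmanantSlice — crux `EvenCycleDominance` (stmt-ValiantsHypothesis-4211): the 3-cycle blocks

The all-ones-return gadget (`ImmanantSliceGadgetK.lean`) with `β` a product of `r` disjoint 3-cycles
`(e_j a_j m_j)` on `Fin (r*3)` (`betaThree`), `E = {e_j}` (`blockE`, enumerated by `blockEquiv`).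
For the survivor `σ_τ = β ε(τ)` (`survivor_eq`): `σ_τ(e_j) = a_{τ j}`, `σ_τ(a_j) = m_j`,
`σ_τ(m_j) = e_j`, so `σ_τ` is fixed-point free (`survivor_ne_self`), `σ_τ³` is three disjoint copies
of `τ` (`survivor_pow_three_apply`), `sign σ_τ = sign τ` (`sign_survivor`), and — through the
alternating-colouring criterion of `ImmanantSliceEvenCyclesColoring.lean` — all cycles of `σ_τ` are
even iff `τ` admits an alternating colouring (`survivor_even_iff`). Consequently the coefficient
function `χ` of the signed even-cycle-cover family `D^even` takes on `σ_τ` the value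
`[τ colourable] · sign τ` (`chi_survivor`), and the gadget identity becomes
`aeval s (D^even_{3r}) = C(A r) · per_r` with the CLASS SUM
`A r = Σ_{τ ∈ S_r} [τ admits an alternating colouring] · sign τ` (`aeval_evenCycleCover`).
(`A (2j) = −(2j−1)!!(2j−3)!! ≠ 0` is the remaining combinatorial input of the reduction; see the
item's evidence note.)

Honest framing: bookkeeping for a VNP-hardness reduction of one slice family; nothing here bears on
VP ≠ VNP.
-/

set_option linter.dupNamespace false

noncomputable section

namespace Summit.ValiantsHypothesis.ValiantsHypothesis.Theorems.ImmanantSlice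

open MvPolynomial Finset Equiv
open Literature.Computability.AlgebraicComplexity

/-! ## The blocks -/

/-- The points `e_j = (j, 0)` of `Fin (r * 3) ≃ Fin r × Fin 3`, as an embedding. [folklore] -/
def blockEmb (r : ℕ) : Fin r ↪ Fin (r * 3) :=
  ⟨fun j => finProdFinEquiv (j, (0 : Fin 3)), fun j j' h => by
    have := finProdFinEquiv.injective h
    simpa using this⟩

/-- The block `E = {e_j}`. [folklore] -/
def blockE (r : ℕ) : Finset (Fin (r * 3)) := Finset.univ.map (blockEmb r)

/-- The enumeration `fE : Fin r ≃ E`. [folklore] -/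
def blockEquiv (r : ℕ) : Fin r ≃ {x // x ∈ blockE r} :=
  (Equiv.ofInjective _ (blockEmb r).injective).trans
    (Equiv.subtypeEquivRight fun x => by simp [blockE, Set.mem_range, Finset.mem_map])

/-- `β`: the product of the 3-cycles `(e_j a_j m_j) = ((j,0) (j,1) (j,2))`. [folklore] -/
def betaThree (r : ℕ) : Perm (Fin (r * 3)) :=
  (finProdFinEquiv : Fin r × Fin 3 ≃ Fin (r * 3)).permCongr
    (Equiv.prodCongrRight fun _ : Fin r => finRotate 3)

/-- The class sum of the reduction: `A r = Σ_{τ ∈ S_r} [τ admits an alternating colouring] · sign τ`.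
[folklore] -/
def classSumA (r : ℕ) : ℂ :=
  ∑ τ : Perm (Fin r), if ∃ d : Fin r → Bool, ∀ j, d (τ j) = !d j then ((Perm.sign τ : ℤ) : ℂ) else 0

variable (r : ℕ)

/-- `fE j = e_j = (j, 0)`. [folklore] -/
theorem blockEquiv_apply (j : Fin r) :
    ((blockEquiv r j : {x // x ∈ blockE r}) : Fin (r * 3)) = finProdFinEquiv (j, (0 : Fin 3)) := rfl

/-- Membership in `E`. [folklore] -/
theorem mem_blockE {x : Fin (r * 3)} : x ∈ blockE r ↔ ∃ j : Fin r, finProdFinEquiv (j, (0 : Fin 3)) = x := by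
  simp [blockE, blockEmb]

/-- Points `(j, i)` with `i ≠ 0` are not in `E`. [folklore] -/
theorem not_mem_blockE {j : Fin r} {i : Fin 3} (hi : i ≠ 0) : finProdFinEquiv (j, i) ∉ blockE r := by
  rw [mem_blockE]
  rintro ⟨j', h⟩
  have := (finProdFinEquiv.injective h)
  simp only [Prod.mk.injEq] at this
  exact hi this.2.symm

/-- The 3-cycle `finRotate 3`. [folklore] -/
theorem finRotate_three_apply :
    finRotate 3 (0 : Fin 3) = 1 ∧ finRotate 3 (1 : Fin 3) = 2 ∧ finRotate 3 (2 : Fin 3) = 0 := by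
  refine ⟨?_, ?_, ?_⟩ <;> decide

/-- `β (j, i) = (j, i + 1)`. [folklore] -/
theorem betaThree_apply (j : Fin r) (i : Fin 3) :
    betaThree r (finProdFinEquiv (j, i)) = finProdFinEquiv (j, finRotate 3 i) := by
  simp [betaThree, Equiv.permCongr_apply]

/-- `β` maps `E` off `E`. [folklore] -/
theorem betaThree_not_mem (x : Fin (r * 3)) (hx : x ∈ blockE r) : betaThree r x ∉ blockE r := by
  obtain ⟨j, rfl⟩ := (mem_blockE r).1 hx
  rw [betaThree_apply, finRotate_three_apply.1]
  exact not_mem_blockE r (by decide)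

/-! ## The survivors `σ_τ = β ε(τ)` -/

/-- `gadgetPerm β E fE 1 τ = β ε(τ)`. [folklore] -/
theorem survivor_eq (τ : Perm (Fin r)) :
    gadgetPerm (betaThree r) (blockE r) (blockEquiv r) 1 τ =
      betaThree r * blockPerm (blockE r) (blockEquiv r) τ := by
  rw [gadgetPerm, blockPerm_one]; group

/-- `σ_τ (e_j) = a_{τ j}`. [folklore] -/
theorem survivor_apply_zero (τ : Perm (Fin r)) (j : Fin r) :
    gadgetPerm (betaThree r) (blockE r) (blockEquiv r) 1 τ (finProdFinEquiv (j, (0 : Fin 3))) =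
      finProdFinEquiv (τ j, (1 : Fin 3)) := by
  rw [survivor_eq, Perm.mul_apply, ← blockEquiv_apply, blockPerm_apply_fE, blockEquiv_apply,
    betaThree_apply, finRotate_three_apply.1]

/-- `σ_τ (a_j) = m_j`. [folklore] -/
theorem survivor_apply_one (τ : Perm (Fin r)) (j : Fin r) :
    gadgetPerm (betaThree r) (blockE r) (blockEquiv r) 1 τ (finProdFinEquiv (j, (1 : Fin 3))) =
      finProdFinEquiv (j, (2 : Fin 3)) := by
  rw [survivor_eq, Perm.mul_apply, blockPerm_apply_of_not_mem _ _ τ (not_mem_blockE r (by decide)),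
    betaThree_apply, finRotate_three_apply.2.1]

/-- `σ_τ (m_j) = e_j`. [folklore] -/
theorem survivor_apply_two (τ : Perm (Fin r)) (j : Fin r) :
    gadgetPerm (betaThree r) (blockE r) (blockEquiv r) 1 τ (finProdFinEquiv (j, (2 : Fin 3))) =
      finProdFinEquiv (j, (0 : Fin 3)) := by
  rw [survivor_eq, Perm.mul_apply, blockPerm_apply_of_not_mem _ _ τ (not_mem_blockE r (by decide)),
    betaThree_apply, finRotate_three_apply.2.2]

/-- `σ_τ` is fixed-point free. [folklore] -/
theorem survivor_ne_self (τ : Perm (Fin r)) (y : Fin (r * 3)) :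
    gadgetPerm (betaThree r) (blockE r) (blockEquiv r) 1 τ y ≠ y := by
  obtain ⟨⟨j, i⟩, rfl⟩ := finProdFinEquiv.surjective y
  intro h
  fin_cases i
  · rw [show ((⟨0, by norm_num⟩ : Fin 3)) = 0 from rfl, survivor_apply_zero] at h
    have := finProdFinEquiv.injective h
    simp at this
  · rw [show ((⟨1, by norm_num⟩ : Fin 3)) = 1 from rfl, survivor_apply_one] at h
    have := finProdFinEquiv.injective h
    simp at this
  · rw [show ((⟨2, by norm_num⟩ : Fin 3)) = 2 from rfl, survivor_apply_two] at h
    have := finProdFinEquiv.injective h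
    simp at this

/-- `σ_τ³` is three disjoint copies of `τ`: `σ_τ³ (j, i) = (τ j, i)`. [folklore] -/
theorem survivor_pow_three_apply (τ : Perm (Fin r)) (j : Fin r) (i : Fin 3) :
    (gadgetPerm (betaThree r) (blockE r) (blockEquiv r) 1 τ ^ 3) (finProdFinEquiv (j, i)) =
      finProdFinEquiv (τ j, i) := by
  have h3 : ∀ (g : Perm (Fin (r * 3))) (x : Fin (r * 3)), (g ^ 3) x = g (g (g x)) := by
    intro g x; simp only [pow_succ, pow_zero, one_mul, Perm.mul_apply]
  rw [h3]
  fin_cases i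
  · rw [show ((⟨0, by norm_num⟩ : Fin 3)) = 0 from rfl, survivor_apply_zero, survivor_apply_one,
      survivor_apply_two]
  · rw [show ((⟨1, by norm_num⟩ : Fin 3)) = 1 from rfl, survivor_apply_one, survivor_apply_two,
      survivor_apply_zero]
  · rw [show ((⟨2, by norm_num⟩ : Fin 3)) = 2 from rfl, survivor_apply_two, survivor_apply_zero,
      survivor_apply_one]

/-- All cycles of `σ_τ` are even iff `τ` admits an alternating colouring. [folklore] -/
theorem survivor_even_iff (τ : Perm (Fin r)) :
    (∀ m ∈ (gadgetPerm (betaThree r) (blockE r) (blockEquiv r) 1 τ).cycleType, Even m) ↔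
      ∃ d : Fin r → Bool, ∀ j, d (τ j) = !d j := by
  rw [even_cycleType_iff_exists_coloring _ (survivor_ne_self r τ), exists_coloring_iff_pow_three]
  constructor
  · rintro ⟨c, hc⟩
    refine ⟨fun j => c (finProdFinEquiv (j, (0 : Fin 3))), fun j => ?_⟩
    show c (finProdFinEquiv (τ j, (0 : Fin 3))) = !c (finProdFinEquiv (j, (0 : Fin 3)))
    rw [← survivor_pow_three_apply r τ j 0, hc]
  · rintro ⟨d, hd⟩
    refine ⟨fun y => d (finProdFinEquiv.symm y).1, fun y => ?_⟩
    obtain ⟨⟨j, i⟩, rfl⟩ := finProdFinEquiv.surjective y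
    simp only [survivor_pow_three_apply, Equiv.symm_apply_apply]
    exact hd j

/-- `sign σ_τ = sign τ` (the 3-cycles are even). [folklore] -/
theorem sign_survivor (τ : Perm (Fin r)) :
    Perm.sign (gadgetPerm (betaThree r) (blockE r) (blockEquiv r) 1 τ) = Perm.sign τ := by
  rw [survivor_eq, Perm.sign_mul, blockPerm, Perm.sign_extendDomain]
  have hβ : Perm.sign (betaThree r) = 1 := by
    rw [betaThree, Perm.sign_permCongr, Perm.sign_prodCongrRight]
    refine Finset.prod_eq_one fun j _ => ?_
    rw [sign_finRotate]; norm_num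
  rw [hβ, one_mul]

/-! ## The coefficient function of `D^even` on the survivors -/

/-- The coefficient function of the even-cycle-cover family is a class function. [folklore] -/
theorem chi_isClassFunction {n : ℕ} (σ σ' : Perm (Fin n)) (h : IsConj σ σ') :
    (if (∀ i, σ i ≠ i) ∧ (∀ m ∈ σ.cycleType, Even m) then (((Perm.sign σ : ℤ) : ℂ)) else 0) =
      (if (∀ i, σ' i ≠ i) ∧ (∀ m ∈ σ'.cycleType, Even m) then (((Perm.sign σ' : ℤ) : ℂ)) else 0) := by
  have hct : σ.cycleType = σ'.cycleType := Perm.isConj_iff_cycleType_eq.1 h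
  obtain ⟨c, hc⟩ := isConj_iff.1 h
  have hsign : Perm.sign σ' = Perm.sign σ := by
    rw [← hc, Perm.sign_mul, Perm.sign_mul, Perm.sign_inv, mul_right_comm, Int.units_mul_self,
      one_mul]
  have hder : (∀ i, σ i ≠ i) ↔ (∀ i, σ' i ≠ i) := by
    rw [← hc]
    constructor
    · intro hσ i hi
      apply hσ (c⁻¹ i)
      have := congrArg (fun x => c⁻¹ x) hi
      simpa [Perm.mul_apply] using this
    · intro hσ' i hi
      apply hσ' (c i)
      simp [Perm.mul_apply, hi]
  rw [hct, hsign]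
  simp only [hder]

/-- **The coefficient of `D^even` at a survivor**: `χ(σ_τ) = [τ colourable] · sign τ`. [folklore] -/
theorem chi_survivor (τ : Perm (Fin r)) :
    (if (∀ i, gadgetPerm (betaThree r) (blockE r) (blockEquiv r) 1 τ i ≠ i) ∧
        (∀ m ∈ (gadgetPerm (betaThree r) (blockE r) (blockEquiv r) 1 τ).cycleType, Even m) then
        (((Perm.sign (gadgetPerm (betaThree r) (blockE r) (blockEquiv r) 1 τ) : ℤ) : ℂ)) else 0) =
      if ∃ d : Fin r → Bool, ∀ j, d (τ j) = !d j then ((Perm.sign τ : ℤ) : ℂ) else 0 := by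
  rw [sign_survivor]
  have hiff : ((∀ i, gadgetPerm (betaThree r) (blockE r) (blockEquiv r) 1 τ i ≠ i) ∧
      (∀ m ∈ (gadgetPerm (betaThree r) (blockE r) (blockEquiv r) 1 τ).cycleType, Even m)) ↔
      ∃ d : Fin r → Bool, ∀ j, d (τ j) = !d j := by
    rw [← survivor_even_iff]
    exact ⟨fun h => h.2, fun h => ⟨survivor_ne_self r τ, h⟩⟩
  simp only [hiff]

/-- **The gadget identity for `D^even`**: `aeval s (D^even_{3r}) = C(A r) · per_r`. [folklore] -/
theorem aeval_evenCycleCover (r : ℕ) :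
    aeval (ArithCircuit.substVCFun (gadgetSubstK ℂ (betaThree r) (blockE r) (blockEquiv r)))
        (∑ σ : Perm (Fin (r * 3)), C (if (∀ i, σ i ≠ i) ∧ (∀ m ∈ σ.cycleType, Even m) then
          (((Perm.sign σ : ℤ) : ℂ)) else 0) * ∏ i : Fin (r * 3), X (σ i, i)) =
      C (classSumA r) * perPoly (Fin r) ℂ := by
  rw [aeval_gadgetSubstK_slice (blockEquiv r) (betaThree_not_mem r) _ chi_isClassFunction,
    perPoly_eq_sum, classSumA]
  congr 2
  exact Finset.sum_congr rfl fun τ _ => chi_survivor r τ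

end Summit.ValiantsHypothesis.ValiantsHypothesis.Theorems.ImmanantSlice
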